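import Mathlib
import Literature.Computability.Complexity.GraphEncodings
import Literature.Computability.Complexity.FoldCatBricks
import Literature.Computability.Complexity.UnaryOffsets
import Literature.Computability.Complexity.UnaryBricks
import Literature.Computability.Complexity.FPStringBricks
import Literature.Computability.Complexity.PlumbingBricks
import Summits.PneNP.PneNP.Theorems.SymmetryBudgetWindowBarrierRankDict

/-!
# Extraction bricks I for stub `stub_completeInvariantFP_of_canonicalForm` (line
`canonical-form-completeness`, crux `SymmetryBudget.WindowBarrier`, item stmt-PneNP-2145)

`FP` string functions, assembled from the tree's brick algebra only (no machine is programmed),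
that read the *ordered / free* block structure off the code `⟨encodeNat m, A⟩` of an `m`-vertex
graph (`A` = row-major adjacency bits, `GraphEncodings.lean`), where the last `g = ⌊log₂ m⌋`
vertices are FREE and the first `n = m - g` are ORDERED:

* `unM`, `unG`, `unN` — the unary numerals `1ᵐ`, `1ᵍ`, `1ⁿ` (`binToUnaryFn`, `Brick.logFn`, `dropFn`);
* `winPiece o L` — the window of `A` at offset `|o z|` of length `|L z|` (`UnaryOffsets.windowFn`);
  instances `fxPiece` (row `t`, first `n` columns), `attPiece` (row `n + t`, first `n` columns:
  the ATTACHMENT vector of free vertex `t`), `frPiece` (row `n + t`, columns `n … m-1`);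
* `fixedFn = ccat_{t<n} fxPiece`, `freeFn = ccat_{t<g} frPiece` (`Brick.foldCat`), with their
  values on codes and size bounds on every input.

All functions are total; values are stated on pairs `⟨h, A⟩` with `⟦h⟧ = m`, `|A| = m²`.
-/

-- `Summit.PneNP.PneNP.…` duplicates `PneNP` BY DESIGN (single-problem summit).
set_option linter.dupNamespace false

namespace Summit.PneNP.PneNP.Theorems.CompleteInvariant

open Literature.Computability.Complexity Brick Plumb UnaryOffsets
open _root_.Computability Polynomial

/-! ### The three unary parameters -/

/-- `unM ⟨h, A⟩ = 1^{min ⟦h⟧ |A|}`; on a graph code (`⟦h⟧ = m`, `|A| = m²`) this is `1ᵐ`. -/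
noncomputable def unM : List Bool → List Bool := binToUnaryFn ∘ fanoutFn sndF fstF

/-- `unG = 1^{⌊log₂ |unM|⌋}`; on a graph code this is `1ᵍ`, `g = ⌊log₂ m⌋`. -/
noncomputable def unG : List Bool → List Bool := logFn ∘ unM

/-- `unN = unM ⇂ |unG|`; on a graph code this is `1ⁿ`, `n = m - ⌊log₂ m⌋`. -/
noncomputable def unN : List Bool → List Bool := dropFn ∘ fanoutFn unG unM

/-- `unM ∈ FP`. -/
theorem unM_mem_FP : unM ∈ FP :=
  comp_mem_FP binToUnaryFn_mem_FP (fanoutFn_mem_FP sndF_mem_FP fstF_mem_FP)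

/-- `unG ∈ FP`. -/
theorem unG_mem_FP : unG ∈ FP := comp_mem_FP logFn_mem_FP unM_mem_FP

/-- `unN ∈ FP`. -/
theorem unN_mem_FP : unN ∈ FP := comp_mem_FP dropFn_mem_FP (fanoutFn_mem_FP unG_mem_FP unM_mem_FP)

/-- Value of `unM` on every input. -/
theorem unM_apply (w : List Bool) : unM w = ones (min (bitsToNat (fstF w)) (sndF w).length) := by
  simp [unM]

/-- `|unM w| ≤ |w|`. -/
theorem length_unM_le (w : List Bool) : (unM w).length ≤ w.length := by
  rw [unM_apply]
  have := length_fstF_sndF_le w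
  simp [ones]
  omega

/-- `m ≤ m²`. -/
theorem le_mul_self' (m : ℕ) : m ≤ m * m := by
  rcases Nat.eq_zero_or_pos m with rfl | h
  · simp
  · exact Nat.le_mul_of_pos_left m h

/-- `unM` on a graph code. -/
theorem unM_code {m : ℕ} {A : List Bool} (hA : A.length = m * m) :
    unM (boolPair (encodeNat m) A) = ones m := by
  rw [unM_apply, fstF_boolPair, sndF_boolPair, bitsToNat_encodeNat, hA, Nat.min_eq_left (le_mul_self' m)]

/-- Value of `unG` on every input. -/
theorem unG_apply (w : List Bool) : unG w = ones (Nat.log 2 (unM w).length) := rfl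

/-- `|unG w| ≤ ⌊log₂ |w|⌋`. -/
theorem length_unG_le (w : List Bool) : (unG w).length ≤ Nat.log 2 w.length := by
  rw [unG_apply]
  simpa [ones] using Nat.log_mono_right (length_unM_le w)

/-- `|unG w| ≤ |w|`. -/
theorem length_unG_le' (w : List Bool) : (unG w).length ≤ w.length :=
  (length_unG_le w).trans (Nat.log_le_self 2 _)

/-- `unG` on a graph code. -/
theorem unG_code {m : ℕ} {A : List Bool} (hA : A.length = m * m) :
    unG (boolPair (encodeNat m) A) = ones (Nat.log 2 m) := by
  rw [unG_apply, unM_code hA]; simp [ones]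

/-- Value of `unN` on every input. -/
theorem unN_apply (w : List Bool) : unN w = ones ((unM w).length - (unG w).length) := by
  simp only [unN, Function.comp_apply, fanoutFn_apply, dropFn_boolPair, unM_apply]
  simp [ones]

/-- `|unN w| ≤ |w|`. -/
theorem length_unN_le (w : List Bool) : (unN w).length ≤ w.length := by
  rw [unN_apply]
  have := length_unM_le w
  simp [ones]; omega

/-- `unN` on a graph code. -/
theorem unN_code {m : ℕ} {A : List Bool} (hA : A.length = m * m) :
    unN (boolPair (encodeNat m) A) = ones (m - Nat.log 2 m) := by
  rw [unN_apply, unG_code hA, unM_code hA]; simp [ones]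


/-! ### Windows of the adjacency string -/

/-- `winPiece o L`: on `z = ⟨w, u⟩`, the window of `A = sndF w` at offset `|o z|` of length `|L z|`
(zero-padded; `UnaryOffsets.windowFn X`). -/
noncomputable def winPiece (o L : List Bool → List Bool) : List Bool → List Bool :=
  windowFn X ∘ fanoutFn (fanoutFn (sndF ∘ fstF) o) L

/-- `winPiece o L ∈ FP` for `o, L ∈ FP`. -/
theorem winPiece_mem_FP {o L : List Bool → List Bool} (ho : o ∈ FP) (hL : L ∈ FP) : winPiece o L ∈ FP :=
  comp_mem_FP (windowFn_mem_FP X) (fanoutFn_mem_FP (fanoutFn_mem_FP (comp_mem_FP sndF_mem_FP fstF_mem_FP) ho) hL)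

/-- Value of `winPiece` on every input. -/
theorem winPiece_apply (o L : List Bool → List Bool) (z : List Bool) :
    winPiece o L z = window (sndF (fstF z)) (o z).length (L z).length := by
  simp [winPiece, windowFn_apply]

/-- `|winPiece o L z| = |L z|`. -/
@[simp] theorem length_winPiece (o L : List Bool → List Bool) (z : List Bool) :
    (winPiece o L z).length = (L z).length := by
  rw [winPiece_apply, length_window]

/-- The offset `|u| · m` (on `⟨w, u⟩`): `mulLenFn ⟨u, unM w⟩`. -/
noncomputable def offRow : List Bool → List Bool := mulLenFn ∘ fanoutFn sndF (unM ∘ fstF)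

/-- The offset `(n + |u|) · m` (on `⟨w, u⟩`). -/
noncomputable def offFree : List Bool → List Bool :=
  mulLenFn ∘ fanoutFn (appF ∘ fanoutFn (unN ∘ fstF) sndF) (unM ∘ fstF)

/-- The offset `(n + |u|) · m + n` (on `⟨w, u⟩`). -/
noncomputable def offFree' : List Bool → List Bool := appF ∘ fanoutFn offFree (unN ∘ fstF)

/-- `offRow ∈ FP`. -/
theorem offRow_mem_FP : offRow ∈ FP :=
  comp_mem_FP mulLenFn_mem_FP (fanoutFn_mem_FP sndF_mem_FP (comp_mem_FP unM_mem_FP fstF_mem_FP))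

/-- `offFree ∈ FP`. -/
theorem offFree_mem_FP : offFree ∈ FP :=
  comp_mem_FP mulLenFn_mem_FP (fanoutFn_mem_FP
    (comp_mem_FP appF_mem_FP (fanoutFn_mem_FP (comp_mem_FP unN_mem_FP fstF_mem_FP) sndF_mem_FP))
    (comp_mem_FP unM_mem_FP fstF_mem_FP))

/-- `offFree' ∈ FP`. -/
theorem offFree'_mem_FP : offFree' ∈ FP :=
  comp_mem_FP appF_mem_FP (fanoutFn_mem_FP offFree_mem_FP (comp_mem_FP unN_mem_FP fstF_mem_FP))

/-- `|offRow ⟨w, u⟩| = |u| · |unM w|`. -/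
@[simp] theorem length_offRow (w u : List Bool) : (offRow (boolPair w u)).length = u.length * (unM w).length := by
  simp [offRow]

/-- `|offFree ⟨w, u⟩| = (|unN w| + |u|) · |unM w|`. -/
@[simp] theorem length_offFree (w u : List Bool) :
    (offFree (boolPair w u)).length = ((unN w).length + u.length) * (unM w).length := by
  simp [offFree]

/-- `|offFree' ⟨w, u⟩| = (|unN w| + |u|) · |unM w| + |unN w|`. -/
@[simp] theorem length_offFree' (w u : List Bool) :
    (offFree' (boolPair w u)).length = ((unN w).length + u.length) * (unM w).length + (unN w).length := by
  simp [offFree', offFree]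

/-- Row `|u|`, first `n` columns: `window A (|u| m) n`. -/
noncomputable def fxPiece : List Bool → List Bool := winPiece offRow (unN ∘ fstF)

/-- Row `n + |u|`, first `n` columns (the attachment vector of free vertex `|u|`): `window A ((n + |u|) m) n`. -/
noncomputable def attPiece : List Bool → List Bool := winPiece offFree (unN ∘ fstF)

/-- Row `n + |u|`, columns `n, …, n + g - 1` (row `|u|` of the free block): `window A ((n + |u|) m + n) g`. -/
noncomputable def frPiece : List Bool → List Bool := winPiece offFree' (unG ∘ fstF)

/-- `fxPiece ∈ FP`. -/
theorem fxPiece_mem_FP : fxPiece ∈ FP := winPiece_mem_FP offRow_mem_FP (comp_mem_FP unN_mem_FP fstF_mem_FP)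

/-- `attPiece ∈ FP`. -/
theorem attPiece_mem_FP : attPiece ∈ FP := winPiece_mem_FP offFree_mem_FP (comp_mem_FP unN_mem_FP fstF_mem_FP)

/-- `frPiece ∈ FP`. -/
theorem frPiece_mem_FP : frPiece ∈ FP := winPiece_mem_FP offFree'_mem_FP (comp_mem_FP unG_mem_FP fstF_mem_FP)

/-- Value of `fxPiece` on a pair. -/
theorem fxPiece_boolPair (w u : List Bool) :
    fxPiece (boolPair w u) = window (sndF w) (u.length * (unM w).length) (unN w).length := by
  rw [fxPiece, winPiece_apply, length_offRow]; simp

/-- Value of `attPiece` on a pair. -/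
theorem attPiece_boolPair (w u : List Bool) :
    attPiece (boolPair w u) = window (sndF w) (((unN w).length + u.length) * (unM w).length) (unN w).length := by
  rw [attPiece, winPiece_apply, length_offFree]; simp

/-- Value of `frPiece` on a pair. -/
theorem frPiece_boolPair (w u : List Bool) :
    frPiece (boolPair w u) =
      window (sndF w) (((unN w).length + u.length) * (unM w).length + (unN w).length) (unG w).length := by
  rw [frPiece, winPiece_apply, length_offFree']; simp

/-- `|fxPiece z| = |unN (fstF z)|`. -/
@[simp] theorem length_fxPiece (z : List Bool) : (fxPiece z).length = (unN (fstF z)).length := length_winPiece _ _ z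

/-- `|attPiece z| = |unN (fstF z)|`. -/
@[simp] theorem length_attPiece (z : List Bool) : (attPiece z).length = (unN (fstF z)).length := length_winPiece _ _ z

/-- `|frPiece z| = |unG (fstF z)|`. -/
@[simp] theorem length_frPiece (z : List Bool) : (frPiece z).length = (unG (fstF z)).length := length_winPiece _ _ z

/-! ### The fixed block and the free block -/

/-- **The ordered × ordered block**: `fixedFn w = ccat_{t < n} window A (t m) n` (row prefixes). -/
noncomputable def fixedFn : List Bool → List Bool := foldCat X X fxPiece ∘ fanoutFn id unN

/-- **The free × free block**: `freeFn w = ccat_{t < g} window A ((n + t) m + n) g`, the row-major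
adjacency string of the graph induced on the free vertices. -/
noncomputable def freeFn : List Bool → List Bool := foldCat X X frPiece ∘ fanoutFn id unG

/-- `fixedFn ∈ FP`. -/
theorem fixedFn_mem_FP : fixedFn ∈ FP :=
  comp_mem_FP (foldCat_mem_FP X X fxPiece_mem_FP) (fanoutFn_mem_FP (PolyTimeComputable.id _) unN_mem_FP)

/-- `freeFn ∈ FP`. -/
theorem freeFn_mem_FP : freeFn ∈ FP :=
  comp_mem_FP (foldCat_mem_FP X X frPiece_mem_FP) (fanoutFn_mem_FP (PolyTimeComputable.id _) unG_mem_FP)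

/-- **Value of `fixedFn` on every input.** -/
theorem fixedFn_apply (w : List Bool) :
    fixedFn w = ccat (fun t => window (sndF w) (t * (unM w).length) (unN w).length) (unN w).length := by
  have h := foldCat_apply (Q := X) (p := X) (f := fxPiece) (x := w) (u := unN w)
    (by simpa using length_unN_le w) (fun t _ => by simp [length_unN_le])
  simp only [fixedFn, Function.comp_apply, fanoutFn_apply, id, h]
  refine ccat_congr fun t _ => ?_
  rw [fxPiece_boolPair]; simp [ones]

/-- **Value of `freeFn` on every input.** -/
theorem freeFn_apply (w : List Bool) :
    freeFn w = ccat (fun t => window (sndF w) (((unN w).length + t) * (unM w).length + (unN w).length)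
      (unG w).length) (unG w).length := by
  have h := foldCat_apply (Q := X) (p := X) (f := frPiece) (x := w) (u := unG w)
    (by simpa using length_unG_le' w) (fun t _ => by simp [length_unG_le'])
  simp only [freeFn, Function.comp_apply, fanoutFn_apply, id, h]
  refine ccat_congr fun t _ => ?_
  rw [frPiece_boolPair]; simp [ones]

/-- `|freeFn w| ≤ |unG w|²`. -/
theorem length_freeFn_le (w : List Bool) : (freeFn w).length ≤ (unG w).length * (unG w).length := by
  rw [freeFn_apply]
  exact length_ccat_le _ _ (fun t => by rw [length_window]) _


/-! ### Attachment vectors and ranks -/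

/-- The attachment vector of free vertex `t` read off `w`: `window A ((n + t) m) n`. -/
noncomputable def attOf (w : List Bool) (t : ℕ) : List Bool :=
  window (sndF w) (((unN w).length + t) * (unM w).length) (unN w).length

/-- `attPiece ⟨w, u⟩ = attOf w |u|`. -/
theorem attPiece_eq_attOf (w u : List Bool) : attPiece (boolPair w u) = attOf w u.length :=
  attPiece_boolPair w u

/-- `|attOf w t| = |unN w|`. -/
@[simp] theorem length_attOf (w : List Bool) (t : ℕ) : (attOf w t).length = (unN w).length := length_window _ _ _

/-- **The rank** of free vertex `t`: the number of free vertices `i < g` whose attachment vector has a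
smaller binary value (`bitsToNat`, least significant bit first). A canonical renaming of the occurring
attachment vectors by numbers `< g`. -/
noncomputable def rankOf (w : List Bool) (t : ℕ) : ℕ := rankFam (attOf w) (unG w).length t

/-- `rankOf w t ≤ |unG w|`. -/
theorem rankOf_le (w : List Bool) (t : ℕ) : rankOf w t ≤ (unG w).length := rankFam_le _ _ _

/-- `⟨⟨w, u⟩, v⟩ ↦ ⟨w, v⟩`: the context of an inner loop re-paired with the inner index. -/
noncomputable def inner : List Bool → List Bool := fanoutFn (fstF ∘ fstF) sndF

/-- `inner ∈ FP`. -/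
theorem inner_mem_FP : inner ∈ FP := fanoutFn_mem_FP (comp_mem_FP fstF_mem_FP fstF_mem_FP) sndF_mem_FP

/-- `inner` on a record. -/
@[simp] theorem inner_apply (w u v : List Bool) : inner (boolPair (boolPair w u) v) = boolPair w v := by
  simp [inner]

/-- The comparison piece of the rank loop: on `⟨⟨w, 1ᵗ⟩, 1ⁱ⟩`, `[1]` if `⟦att i⟧ < ⟦att t⟧`, else `ε`. -/
noncomputable def ltPiece : List Bool → List Bool :=
  iteFn (ltFn ∘ fanoutFn (attPiece ∘ inner) (attPiece ∘ fstF)) (fun _ => [true]) (fun _ => [])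

/-- `ltPiece ∈ FP`. -/
theorem ltPiece_mem_FP : ltPiece ∈ FP :=
  iteFn_mem_FP (comp_mem_FP ltFn_mem_FP (fanoutFn_mem_FP (comp_mem_FP attPiece_mem_FP inner_mem_FP)
    (comp_mem_FP attPiece_mem_FP fstF_mem_FP))) (const_mem_FP _) (const_mem_FP _)

/-- Value of `ltPiece` on a record. -/
theorem ltPiece_apply (w u v : List Bool) :
    ltPiece (boolPair (boolPair w u) v) =
      if bitsToNat (attOf w v.length) < bitsToNat (attOf w u.length) then [true] else [] := by
  unfold ltPiece
  have hc : (ltFn ∘ fanoutFn (attPiece ∘ inner) (attPiece ∘ fstF)) (boolPair (boolPair w u) v) =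
      [decide (bitsToNat (attOf w v.length) < bitsToNat (attOf w u.length))] := by
    simp [attPiece_eq_attOf]
  rw [iteFn_apply hc]
  by_cases h : bitsToNat (attOf w v.length) < bitsToNat (attOf w u.length) <;> simp [h]

/-- `|ltPiece z| ≤ 1` on every input. -/
theorem length_ltPiece_le (z : List Bool) : (ltPiece z).length ≤ 1 := by
  unfold ltPiece
  obtain ⟨b, hb⟩ := (oneBit_ltFn.comp (fanoutFn (attPiece ∘ inner) (attPiece ∘ fstF))) z
  rw [iteFn_apply hb]
  cases b <;> simp

/-- The length of a concatenation of indicator pieces is a count. -/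
theorem length_ccat_indicator (P : ℕ → Prop) [DecidablePred P] : ∀ k : ℕ,
    (ccat (fun i => if P i then [true] else []) k).length = ((Finset.range k).filter P).card
  | 0 => by simp
  | k + 1 => by
    rw [ccat_succ, List.length_append, length_ccat_indicator P k, Finset.range_add_one, Finset.filter_insert]
    by_cases h : P k
    · rw [if_pos h, if_pos h, Finset.card_insert_of_notMem (by simp)]; rfl
    · rw [if_neg h, if_neg h]; rfl

/-- **The rank in unary**: on `⟨w, 1ᵗ⟩`, `1^{rankOf w t}` (the concatenation of the comparison pieces). -/
noncomputable def rankUn : List Bool → List Bool := foldCat 1 X ltPiece ∘ fanoutFn id (unG ∘ fstF)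

/-- `rankUn ∈ FP`. -/
theorem rankUn_mem_FP : rankUn ∈ FP :=
  comp_mem_FP (foldCat_mem_FP 1 X ltPiece_mem_FP)
    (fanoutFn_mem_FP (PolyTimeComputable.id _) (comp_mem_FP unG_mem_FP fstF_mem_FP))

/-- Value of `rankUn` on a pair, as a concatenation. -/
theorem rankUn_boolPair (w u : List Bool) :
    rankUn (boolPair w u) = ccat (fun i => if bitsToNat (attOf w i) < bitsToNat (attOf w u.length)
      then [true] else []) (unG w).length := by
  have hlen : (unG w).length ≤ X.eval (boolPair w u).length := by
    have := length_unG_le' w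
    simp only [eval_X, length_boolPair]; omega
  have h := foldCat_apply (Q := 1) (p := X) (f := ltPiece) (x := boolPair w u) (u := unG w) hlen
    (fun t _ => by simpa using length_ltPiece_le _)
  simp only [rankUn, Function.comp_apply, fanoutFn_apply, id, fstF_boolPair, h]
  refine ccat_congr fun i _ => ?_
  rw [ltPiece_apply]; simp [ones]

/-- **`|rankUn ⟨w, u⟩| = rankOf w |u|`.** -/
theorem length_rankUn_boolPair (w u : List Bool) : (rankUn (boolPair w u)).length = rankOf w u.length := by
  rw [rankUn_boolPair, length_ccat_indicator]; rfl

/-- **The rank piece**: on `⟨w, 1ᵗ⟩`, the numeral `encodeNat (rankOf w t)`. -/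
noncomputable def rankPiece : List Bool → List Bool := lenBinF ∘ rankUn

/-- `rankPiece ∈ FP`. -/
theorem rankPiece_mem_FP : rankPiece ∈ FP := comp_mem_FP lenBinF_mem_FP rankUn_mem_FP

/-- **Value of `rankPiece` on a pair.** -/
@[simp] theorem rankPiece_boolPair (w u : List Bool) : rankPiece (boolPair w u) = encodeNat (rankOf w u.length) := by
  simp [rankPiece, length_rankUn_boolPair]

/-- `|encodeNat k| ≤ k`. -/
theorem length_encodeNat_le_self (k : ℕ) : (encodeNat k).length ≤ k := by
  rw [TM2Pass.length_encodeNat_eq_size]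
  exact Nat.size_le.2 Nat.lt_two_pow_self

/-- `|rankPiece ⟨w, u⟩| ≤ |unG w|`. -/
theorem length_rankPiece_boolPair_le (w u : List Bool) : (rankPiece (boolPair w u)).length ≤ (unG w).length := by
  rw [rankPiece_boolPair]
  exact (length_encodeNat_le_self _).trans (rankOf_le w _)


end Summit.PneNP.PneNP.Theorems.CompleteInvariant

namespace Summit.PneNP.PneNP.Theorems

open Literature.Computability.Complexity CompleteInvariant

/-- **Registered sub-goal of S1b (`stub_completeInvariantFP_rankPiece`)**: the rank piece computes the
canonical numeral of the rank of a free vertex (brick file `SymmetryBudgetWindowBarrierExtractBricks`). -/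
theorem stub_completeInvariantFP_rankPiece : ∀ w u : List Bool, rankPiece (boolPair w u) = Computability.encodeNat (rankOf w u.length) :=
  rankPiece_boolPair

end Summit.PneNP.PneNP.Theorems
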